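import Literature.MathematicalPhysics.QuantumFieldTheory.Balaban1983to89.Node00.CarriersB12
import Literature.MathematicalPhysics.QuantumFieldTheory.Balaban1983to89.Node00.Record11CarriersB8

/-!
# NODE 00 (YM-PLAN Track A) — THE STAGE-11 RECORD WITH ALL SIX TYPED CARRIER GROUPS PINNED: the [Balaban1987RG1] §§2–5 pin `Stage11Params.pinB12` (an `X`-re-binding,
# UP-SIDE), the six-pin view `view₁₁B12B8B10YZW`, the record predicate `IsRecordOfRecord₁₁CB10YZWB8B12` and its SAME-DATUM-SAME-WORLD refinement of g31's
# `IsRecordOfRecord₁₁CB10YZWB8`; the six pinned leaves and N09's conjunct 1 («Lemma 4 at the record») in slots ∕ package form — sequel of `Node00/CarriersB12`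

NODE 00 RECORD MODULE (seat `pub-ymgap-node00-def` g32, 2026-08-26; director-ym R134 (c) trigger t1), sequel of `Node00/CarriersB12` (the instance index `IdxB12`, the residual
layer `ResidB12Run`, the frame of Lemma 4 of record `F12OfRecord`, the leaf `B12LeafOfRecord`; the knit face «displayed by-reference package ⇒ leaf» = lit-balaban p07's
`lemma4Printed_frameOf` BY NAME is the companion module of seat `pub-ymgap-node00-def-B12`, director-ym LINE №72 (3)) and of g31's `Node00/Record11CarriersB8` (the five-pin chain at ₁₁).  APPEND-ONLY: a NEW
importing module; everything it reads is CONSUMED BY NAME.  [Balaban1987RG1] = Commun. Math. Phys. **109** (1987) 249–301; [Balaban1989LargeFieldII] = Commun. Math.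
Phys. **122** (1989) 355–392.

WHAT IS DEFINED ∕ PROVED (kernel bookkeeping, 0 sorry).  §2: `ResidB12 F N M` (one `ResidB12Run` per run, on the run's torus `F.P p.K`); `PrintedCarriersR.withB12`
(`rfl` faces: `withB12_runs10`, `carriers₃_withB12`); `F12OfRecord₁₁ θ lam p := F12OfRecord (θ.Rz p.K) θ.s2.cB (lam p)` and `B12LeafOfRecord₁₁` (the leaf AT A STAGE-11
PARAMETER: 11b's residual (1.15) recipes, `O(1)LMB := θ.s2.cB`, cube size `θ.τ9.M`); the generic device
`Stage9Params.rebindX` with `Provisos₁₀.rebindX` ∕ `Provisos₁₁.rebindX` field by field (g31's kernel lesson 7: X-pin `rfl`s at ₁₁ are stated ONCE at a generic re-binding);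
**`Stage11Params.pinB12 θ lam := θ.rebindX (XB12OfRecord θ lam θ.res.X)`** — admissibility `Iff.rfl`, Stage-3 dictionary `rfl`, the frame of record itself unchanged
(`F12OfRecord₁₁_pinB12 : rfl` — the pin re-binds `X` only; `Rz`, `s2`, `τ9` are kept), `toStage5₁₁_pinB12`, **`datumOfRecord₁₁_pinB12 : rfl` (UP-SIDE)**, `WOfRecord₁₁_pinB12 : rfl`;
the six-pin view `view₁₁B12B8B10YZW` ([B12] innermost, then g31's five-pin view) with `upOfRecord₅CS_view₁₁B12B8B10YZW_b12_iff : Iff.rfl` (the [B10] ∕ [B8] re-bindings and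
`carriers₃` keep the [B12] group) and the other five leaves BY NAME.  §3: **`IsRecordOfRecord₁₁CB10YZWB8B12 D w`** := g31's `IsRecordOfRecord₁₁CB10YZWB8` VERBATIM at the
six-pin view, `lam12 : ResidB12 F N θ.τ9.M` ∃-quantified (data, no law); `exists_world_…` (inhabitation = ₁₁C's); **`isRecordOfRecord₁₁CB10YZWB8_of_…`** (SAME datum, SAME
world: witness `θ.pinB12 lam12`); `exists_isRecordOfRecord₁₁C_of_…` (through g31's same-datum companion); `leaves_iff_of_…` (six leaves); `leaf_b12_iff_of_…`;
`b12_leaf_of_…_of_slots` (N09's CONJUNCT 1 at a record of this module: a closer supplies the leaf at every presenting parameter package — the companion's face «displayed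
by-reference package ⇒ `B12LeafOfRecord₁₁`», nothing else); `unitPair_mem_Uprime_of_provisos` (the leaf's printed domain is non-empty at a record: def-T's `Provisos₁₁.rzLaws`); `…_rebind_of_isRecordOfRecord₁₁C`.
READ RULE for consumers (as ref-C's (B8-1)–(B8-5) at ₁₁): b12-reading sentences port through `leaf_b12_iff_of_…` ∕ `b12_leaf_of_…_of_slots` with `B12LeafOfRecord₁₁` DISPLAYED;
the companion's by-reference package is never a field of the record.  HONEST FRAMING: definitions + kernel bookkeeping; nothing of Bałaban's asserted; N09 NOT discharged; counts
unmoved (5∕28); one finite T⁴ programme at fixed ε — NOT continuum ∕ ℝ⁴ ∕ OS ∕ mass gap ∕ Clay.  No `sorry` ∕ `axiom` ∕ `opaque` ∕ `instance` ∕ `notation`. -/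

noncomputable section

namespace Literature.MathematicalPhysics.QuantumFieldTheory.Balaban1983to89.Node00

open T4Continuum AveragingRT T4FiniteEpsInhabited FlowStep FlowStepRuns DagBinding T4DatumAssembly
open B12RegularSpaces111 (space space' expI)
open B12Eq18Current (ofBackground)
open B12Lemma4Models (slProj)
open B12RegularSpaces111SpecialUnitary (suModel)
open scoped Matrix.Norms.L2Operator

/-! ## §2. The pin on Stage-11 parameters (an `X`-re-binding, UP-SIDE), the six-pin view and its leaves -/

section Pin

variable (F : T4Family) (N : ℕ) [NeZero N]

/-- **The residual [B12] layer over a Stage-11 record**: one `ResidB12Run` per run `p`, on the run's torus `F.P p.K`, at [I]'s cube size `M` of the record.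
[cite: Balaban1987RG1, Lemma 4 p.280 (objects of record, Stage 3′(X.B12))] -/
abbrev ResidB12 (M : ℕ) : Type := ∀ p : B12.RunParams, ResidB12Run (F.P p.K) N M

omit [NeZero N] in
/-- The residual [B12] layer's type is inhabited. [cite: Balaban1987RG1, Lemma 4 p.280 (bookkeeping)] -/
theorem nonempty_residB12 (M : ℕ) : Nonempty (ResidB12 F N M) :=
  ⟨fun _ => Classical.choice nonempty_residB12Run⟩

/-- A carrier bundle with its [B12 §§2–5] group replaced. [cite: Balaban1987RG1, Lemma 4 p.280 (the objects the leaf `b12` reads)] -/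
def _root_.Literature.MathematicalPhysics.QuantumFieldTheory.Balaban1983to89.DagBinding.PrintedCarriersR.withB12 (X : PrintedCarriersR)
    (F12 : B12Sec2to5.Lemma4Frame) (c12 : B12Sec2to5.Lemma4Consts) : PrintedCarriersR :=
  { X with F12 := F12, c12 := c12 }

/-- The substitution does not touch the [B10] group (`rfl`) … [cite: Balaban1985UV3, (1)–(5) p.256 (bookkeeping)] -/
theorem withB12_runs10 (X : PrintedCarriersR) (F12 : B12Sec2to5.Lemma4Frame) (c12 : B12Sec2to5.Lemma4Consts) : (X.withB12 F12 c12).runs10 = X.runs10 := rfl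

/-- … and passes through the Stage-3 substitutions `carriers₃` (`rfl`). [cite: Balaban1984PropagatorsII, pp.223–250 (bookkeeping)] -/
theorem carriers₃_withB12 (θ₃ : Stage3Params) (X : PrintedCarriersR) (F12 : B12Sec2to5.Lemma4Frame) (c12 : B12Sec2to5.Lemma4Consts) :
    carriers₃ θ₃ (X.withB12 F12 c12) = (carriers₃ θ₃ X).withB12 F12 c12 := rfl

/-- **The frame of Lemma 4 of record AT A STAGE-11 PARAMETER** for the run `p`: 11b's residual recipes `θ.Rz p.K`, `O(1)LMB := θ.s2.cB`, cube size `θ.τ9.M`.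
[cite: Balaban1987RG1, Lemma 4 (3.53) p.280, (1.11)–(1.16) p.262] -/
def F12OfRecord₁₁ (θ : Stage11Params F N) (lam : ResidB12 F N θ.τ9.M) (p : B12.RunParams) : B12Sec2to5.Lemma4Frame :=
  F12OfRecord (θ.Rz p.K) θ.s2.cB (lam p)

/-- **The `b12` leaf at the group of record AT A STAGE-11 PARAMETER**, run `p`. [cite: Balaban1987RG1, Lemma 4 (3.53) p.280] -/
def B12LeafOfRecord₁₁ (θ : Stage11Params F N) (lam : ResidB12 F N θ.τ9.M) (p : B12.RunParams) : Prop :=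
  B12LeafOfRecord (θ.Rz p.K) θ.s2.cB (lam p)

/-- Unfolding (`Iff.rfl`). [cite: Balaban1987RG1, Lemma 4 (3.53) p.280 (bookkeeping)] -/
theorem b12LeafOfRecord₁₁_iff (θ : Stage11Params F N) (lam : ResidB12 F N θ.τ9.M) (p : B12.RunParams) :
    B12LeafOfRecord₁₁ F N θ lam p ↔ B12Sec2to5.Lemma4Printed (F12OfRecord₁₁ F N θ lam p) (lam p).consts := Iff.rfl

/-- The run-indexed carrier bundle with its [B12] group := the group of record. [cite: Balaban1987RG1, Lemma 4 p.280 (objects of record)] -/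
def XB12OfRecord (θ : Stage11Params F N) (lam : ResidB12 F N θ.τ9.M) (X : B12.RunParams → PrintedCarriersR) : B12.RunParams → PrintedCarriersR :=
  fun p => (X p).withB12 (F12OfRecord₁₁ F N θ lam p) (lam p).consts

/-- Plumbing: Stage-9 parameters with the run-indexed carrier bundle `X` RE-BOUND (the Stage-9 part of g31's `Stage11Params.rebindX`). [folklore] -/
def Stage9Params.rebindX (θ : Stage9Params F N) (X' : B12.RunParams → PrintedCarriersR) : Stage9Params F N :=
  { θ with res := { θ.res with X := X' } }

/-- `(θ.rebindX X').toStage9Params = θ.toStage9Params.rebindX X'` (`rfl`). [cite: Balaban1988Convergent, p.244 (bookkeeping)] -/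
theorem Stage11Params.toStage9Params_rebindX (θ : Stage11Params F N) (X' : B12.RunParams → PrintedCarriersR) :
    (θ.rebindX F N X').toStage9Params = θ.toStage9Params.rebindX F N X' := rfl

variable {F N} in
/-- The Stage-10 provisos read no carrier: they transport along any `X`-re-binding, field by field … [cite: Balaban1988Convergent, (3.2)–(3.9) pp.265–266; Balaban1987RG1, (0.19) p.255 (bookkeeping)] -/
theorem Stage9Params.Provisos₁₀.rebindX {θ : Stage9Params F N} (h : θ.Provisos₁₀) (X' : B12.RunParams → PrintedCarriersR) : (θ.rebindX F N X').Provisos₁₀ :=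
  ⟨h.intPiece, h.measω, h.measChi, h.zetaUnity, h.zetaAbs, fun p k _ hk => h.rstep p k hk, h.contT⟩

variable {F N} in
/-- … and so do the Stage-11 provisos (the same transport exists Summits-side as `…BalabanUVNodes.N08AtRecord11Sides.provisos₁₁_rebindX`, seat dag-n08, which `Literature/` cannot
import — restated here for the Literature-side pins). [cite: Balaban1988Convergent, (2.23)–(2.42) pp.259–262 (bookkeeping)] -/
theorem Stage11Params.Provisos₁₁.rebindX {θ : Stage11Params F N} (h : θ.Provisos₁₁) (X' : B12.RunParams → PrintedCarriersR) : (θ.rebindX F N X').Provisos₁₁ :=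
  ⟨h.base.rebindX X', h.rzLaws, h.wtLaws, h.alphaPos, h.bg⟩

/-- **The [B12] pin of Stage-11 parameters**: `res.X := XB12OfRecord θ lam res.X`, everything else — in particular 11b's `Rz`, the §2 numerics and 11a's weights the frame
of record READS — unchanged. [cite: Balaban1987RG1, Lemma 4 p.280 (objects of record, Stage 3′(X.B12))] -/
def Stage11Params.pinB12 (θ : Stage11Params F N) (lam : ResidB12 F N θ.τ9.M) : Stage11Params F N :=
  θ.rebindX F N (XB12OfRecord F N θ lam θ.res.X)

/-- The pinned carrier family, unfolded (`rfl`). [cite: Balaban1987RG1, Lemma 4 p.280 (bookkeeping)] -/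
theorem Stage11Params.pinB12_X (θ : Stage11Params F N) (lam : ResidB12 F N θ.τ9.M) (p : B12.RunParams) :
    (θ.pinB12 F N lam).res.X p = (θ.res.X p).withB12 (F12OfRecord₁₁ F N θ lam p) (lam p).consts := rfl

/-- The pin touches neither admissibility (`Iff.rfl`) … [cite: Balaban1987RG1, (1.12) p.262 (hypothesis dictionary; bookkeeping)] -/
theorem Stage11Params.pinB12_admissible_iff (θ : Stage11Params F N) (lam : ResidB12 F N θ.τ9.M) : (θ.pinB12 F N lam).Admissible ↔ θ.Admissible := Iff.rfl

/-- … nor the Stage-3 dictionary (`rfl`) … [cite: Balaban1984PropagatorsII, pp.223–250 (bookkeeping)] -/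
theorem Stage11Params.pinB12_toStage3Params (θ : Stage11Params F N) (lam : ResidB12 F N θ.τ9.M) : (θ.pinB12 F N lam).toStage3Params = θ.toStage3Params := rfl

/-- … nor the frame of record itself (the pin re-binds `X` only; `Rz`, `s2`, `τ9` are kept: `rfl`). [cite: Balaban1987RG1, (1.11)–(1.16) p.262 (bookkeeping)] -/
theorem F12OfRecord₁₁_pinB12 (θ : Stage11Params F N) (lam lam' : ResidB12 F N θ.τ9.M) (p : B12.RunParams) :
    F12OfRecord₁₁ F N (θ.pinB12 F N lam') lam p = F12OfRecord₁₁ F N θ lam p := rfl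

variable {F N} in
/-- The Stage-11 provisos transport along the [B12] pin. [cite: Balaban1988Convergent, (2.23)–(2.42) pp.259–262 (bookkeeping)] -/
theorem Stage11Params.Provisos₁₁.pinB12 {θ : Stage11Params F N} (h : θ.Provisos₁₁) (lam : ResidB12 F N θ.τ9.M) : (θ.pinB12 F N lam).Provisos₁₁ :=
  h.rebindX _

/-- The Stage-11 view of [B12]-pinned parameters IS the re-bound Stage-11 view (`rfl`, through g31's `toStage5₁₁_rebindX`). [cite: Balaban1988Convergent, p.244 (bookkeeping)] -/
theorem Stage11Params.toStage5₁₁_pinB12 (θ : Stage11Params F N) (lam : ResidB12 F N θ.τ9.M) :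
    (θ.pinB12 F N lam).toStage5₁₁ F N = (θ.toStage5₁₁ F N).rebindX F N (XB12OfRecord F N θ lam θ.res.X) :=
  Stage11Params.toStage5₁₁_rebindX F N θ _

/-- THE PIN IS UP-SIDE: the datum of record is unchanged (`rfl`, through g31's `datumOfRecord₁₁_rebindX`). [cite: Balaban1989LargeFieldII, Thm 1 + (0.1) pp.355–356 (bookkeeping)] -/
theorem datumOfRecord₁₁_pinB12 (θ : Stage11Params F N) (h : θ.Provisos₁₁) (lam : ResidB12 F N θ.τ9.M) :
    datumOfRecord₁₁ F N (θ.pinB12 F N lam) (h.pinB12 lam) = datumOfRecord₁₁ F N θ h :=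
  datumOfRecord₁₁_rebindX F N θ h _ (h.pinB12 lam)

/-- `WOfRecord₁₁ (θ.pinB12 lam) = WOfRecord₁₁ θ` (`rfl`: the [IV] bundle reads no carrier of `X`). [cite: Balaban1989LargeFieldI, (0.2) p.176 (bookkeeping)] -/
theorem WOfRecord₁₁_pinB12 (θ : Stage11Params F N) (lam : ResidB12 F N θ.τ9.M) (lamW : ResidW F N) :
    WOfRecord₁₁ F N (θ.pinB12 F N lam) lamW = WOfRecord₁₁ F N θ lamW := rfl

/-- **The six-pin Stage-11 view** ([B12] innermost, then g31's five-pin view `view₁₁B8B10YZW`). [cite: Balaban1987RG1, Lemma 4 p.280; Balaban1985RegularSpaces, Thm 2 p.83 (objects of record)] -/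
def Stage11Params.view₁₁B12B8B10YZW (θ : Stage11Params F N) (lam12 : ResidB12 F N θ.τ9.M) (lam : ResidB8 θ.toStage3Params) (Mstar : ℕ)
    (ops : OpsY N θ.toStage3Params Mstar) (ζ : ResidZ F N) (lamW : ResidW F N) : Stage5Params F N :=
  (θ.pinB12 F N lam12).view₁₁B8B10YZW F N lam Mstar ops ζ lamW

/-- **THE `b12` LEAF OF THE S-BINDING OVER THE SIX-PIN VIEW IS THE LEAF AT THE GROUP OF RECORD** (`Iff.rfl`: the [B10] ∕ [B8] re-bindings and the Stage-3 substitutions keep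
the [B12] group). [cite: Balaban1987RG1, Lemma 4 (3.53) p.280 (the leaf at the objects of record)] -/
theorem upOfRecord₅CS_view₁₁B12B8B10YZW_b12_iff (θ : Stage11Params F N) (lam12 : ResidB12 F N θ.τ9.M) (lam : ResidB8 θ.toStage3Params) (Mstar : ℕ)
    (ops : OpsY N θ.toStage3Params Mstar) (ζ : ResidZ F N) (lamW : ResidW F N) (P : B12.RunParams) :
    (upOfRecord₅CS F N (θ.view₁₁B12B8B10YZW F N lam12 lam Mstar ops ζ lamW) P).b12 ↔ B12LeafOfRecord₁₁ F N θ lam12 P :=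
  Iff.rfl

/-- The same for the C-binding over the six-pin view (`Iff.rfl`). [cite: Balaban1987RG1, Lemma 4 (3.53) p.280 (bookkeeping)] -/
theorem upOfRecord₅C_view₁₁B12B8B10YZW_b12_iff (θ : Stage11Params F N) (lam12 : ResidB12 F N θ.τ9.M) (lam : ResidB8 θ.toStage3Params) (Mstar : ℕ)
    (ops : OpsY N θ.toStage3Params Mstar) (ζ : ResidZ F N) (lamW : ResidW F N) (P : B12.RunParams) :
    (upOfRecord₅C F N (θ.view₁₁B12B8B10YZW F N lam12 lam Mstar ops ζ lamW) P).b12 ↔ B12LeafOfRecord₁₁ F N θ lam12 P :=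
  Iff.rfl

/-- The other five leaves of the S-binding over the six-pin view are the five-pin view's, BY NAME (g31's `upOfRecord₅CS_view₁₁B8B10YZW_leaves` at `θ.pinB12 lam12`).
[cite: Balaban1985RegularSpaces, Lemma 1 – Thm 8 pp.79–101; Balaban1989LargeFieldI, Prop. 1 p.194; Balaban1985BackgroundPropagators, Thm 3.1 p.397; Balaban1985UV3, Thm 1 p.257; Balaban1985Variational, Thm 1 p.279] -/
theorem upOfRecord₅CS_view₁₁B12B8B10YZW_leaves (θ : Stage11Params F N) (lam12 : ResidB12 F N θ.τ9.M) (lam : ResidB8 θ.toStage3Params) (Mstar : ℕ)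
    (ops : OpsY N θ.toStage3Params Mstar) (ζ : ResidZ F N) (lamW : ResidW F N) (P : B12.RunParams) :
    ((upOfRecord₅CS F N (θ.view₁₁B12B8B10YZW F N lam12 lam Mstar ops ζ lamW) P).b12 ↔ B12LeafOfRecord₁₁ F N θ lam12 P) ∧
    ((upOfRecord₅CS F N (θ.view₁₁B12B8B10YZW F N lam12 lam Mstar ops ζ lamW) P).b8 ↔ B8LeafOfRecord θ.toStage3Params lam) ∧
    ((upOfRecord₅CS F N (θ.view₁₁B12B8B10YZW F N lam12 lam Mstar ops ζ lamW) P).rBasicStep ↔ B15Leaf (WOfRecord₁₁ F N θ lamW P)) ∧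
    ((upOfRecord₅CS F N (θ.view₁₁B12B8B10YZW F N lam12 lam Mstar ops ζ lamW) P).b9 ↔ B9LeafX (Y9OfRecord N θ.toStage3Params Mstar ops)) ∧
    ((upOfRecord₅CS F N (θ.view₁₁B12B8B10YZW F N lam12 lam Mstar ops ζ lamW) P).b10 ↔ PrintedUV3V N θ.L) ∧
    ((upOfRecord₅CS F N (θ.view₁₁B12B8B10YZW F N lam12 lam Mstar ops ζ lamW) P).b11 ↔ B11Leaf (Z11OfRecord F N ζ)) :=
  ⟨Iff.rfl, upOfRecord₅CS_view₁₁B8B10YZW_leaves F N (θ.pinB12 F N lam12) lam Mstar ops ζ lamW P⟩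

end Pin

/-! ## §3. `IsRecordOfRecord₁₁CB10YZWB8B12` — plus the [B12 §§2–5] pin; SAME datum, SAME world refinement of `IsRecordOfRecord₁₁CB10YZWB8` -/

section Record11B12

variable (F : T4Family) (N : ℕ) [NeZero N]

/-- **«(D, w) is the record, Stage 11, all SIX typed carrier groups pinned, `b8` surviving»**: g31's `IsRecordOfRecord₁₁CB10YZWB8` VERBATIM except that the view is the six-pin
view, for SOME residual [B12] layer `lam12` (data quantified with the record's parameters; no law assumed).
[cite: Balaban1987RG1, Lemma 4 p.280; Balaban1985RegularSpaces, Lemma 1 – Thm 8 pp.79–101; Balaban1989LargeFieldII, Thm 1 + (0.1) pp.355–356 (objects of record)] -/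
def IsRecordOfRecord₁₁CB10YZWB8B12 (D : FiniteEpsData F (SU N)) (w : WorldP) : Prop :=
  ∃ (θ : Stage11Params F N) (h : θ.Provisos₁₁) (lam12 : ResidB12 F N θ.τ9.M) (lam : ResidB8 θ.toStage3Params) (Mstar : ℕ) (ops : OpsY N θ.toStage3Params Mstar)
    (ζ : ResidZ F N) (lamW : ResidW F N),
    θ.Admissible ∧ D = datumOfRecord₁₁ F N θ h ∧ w.C = D.C ∧ (0 < w.γ ∧ w.γ ≤ θ.γ) ∧ w.L = (θ.L : ℝ) ∧
      ∀ P : B12.RunParams, w.up P = upOfRecord₅CS F N (θ.view₁₁B12B8B10YZW F N lam12 lam Mstar ops ζ lamW) P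

/-- Inhabitation is Stage 11's exactly (all six residual types inhabited). [cite: Balaban1989LargeFieldII, Thm 1 + (0.1) pp.355–356 (bookkeeping)] -/
theorem exists_world_isRecordOfRecord₁₁CB10YZWB8B12 (θ : Stage11Params F N) (h : θ.Provisos₁₁) (hθ : θ.Admissible) (lam12 : ResidB12 F N θ.τ9.M)
    (lam : ResidB8 θ.toStage3Params) (Mstar : ℕ) (ops : OpsY N θ.toStage3Params Mstar) (ζ : ResidZ F N) (lamW : ResidW F N) {γw : ℝ} (hγw : 0 < γw ∧ γw ≤ θ.γ) :
    ∃ w : WorldP, IsRecordOfRecord₁₁CB10YZWB8B12 F N (datumOfRecord₁₁ F N θ h) w ∧ w.γ = γw := by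
  obtain ⟨w₀, -, -⟩ := exists_world_isRecordOfRecord₁₁C F N θ h hθ hγw
  exact ⟨{ w₀ with
      C := (datumOfRecord₁₁ F N θ h).C, γ := γw, L := (θ.L : ℝ), one_lt_L := by exact_mod_cast θ.hL.2,
      up := fun P => upOfRecord₅CS F N (θ.view₁₁B12B8B10YZW F N lam12 lam Mstar ops ζ lamW) P },
    ⟨θ, h, lam12, lam, Mstar, ops, ζ, lamW, hθ, rfl, rfl, hγw, rfl, fun _ => rfl⟩, rfl⟩

variable {F N}
variable {D : FiniteEpsData F (SU N)} {w : WorldP}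

/-- **Refinement `IsRecordOfRecord₁₁CB10YZWB8B12 → IsRecordOfRecord₁₁CB10YZWB8`** with THE SAME datum AND THE SAME world: witness the [B12]-pinned parameters `θ.pinB12 lam12`
(provisos transported field by field, datum `rfl` through `rebindX`, view by definition). [cite: Balaban1989LargeFieldII, Thm 1 + (0.1) pp.355–356 (bookkeeping)] -/
theorem isRecordOfRecord₁₁CB10YZWB8_of_isRecordOfRecord₁₁CB10YZWB8B12 (h : IsRecordOfRecord₁₁CB10YZWB8B12 F N D w) : IsRecordOfRecord₁₁CB10YZWB8 F N D w := by
  obtain ⟨θ, hP, lam12, lam, Mstar, ops, ζ, lamW, hθ, hD, hC, hγ, hL, hup⟩ := h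
  refine ⟨θ.pinB12 F N lam12, hP.pinB12 lam12, lam, Mstar, ops, ζ, lamW, (Stage11Params.pinB12_admissible_iff F N _ _).2 hθ, ?_, hC, hγ, hL, hup⟩
  rw [datumOfRecord₁₁_pinB12]
  exact hD

/-- … hence `→ IsRecordOfRecord₁₁C` through g31's companion-free chain is NOT available (the S-binding); what IS available with the same datum: g31's SAME-DATUM companion in
`IsRecordOfRecord₁₁CB10YZW` of the `…B8` refinement (`Record11CarriersB8.companion_of_isRecordOfRecord₁₁CB10YZWB8`), then `Record11Carriers.isRecordOfRecord₁₁C_of_…`.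
Here: the `₁₁C` record with the same datum at the companion world. [cite: Balaban1989LargeFieldII, Thm 1 + (0.1) pp.355–356 (bookkeeping)] -/
theorem exists_isRecordOfRecord₁₁C_of_isRecordOfRecord₁₁CB10YZWB8B12 (h : IsRecordOfRecord₁₁CB10YZWB8B12 F N D w) :
    ∃ w' : WorldP, IsRecordOfRecord₁₁C F N D w' ∧ w'.C = w.C ∧ w'.γ = w.γ ∧ w'.L = w.L ∧
      (∀ P : B12.RunParams, leavesP w P = { leavesP w' P with b8 := (leavesP w P).b8 }) := by
  obtain ⟨w', hw', hC, hγ, hL, hleaves, -⟩ := companion_of_isRecordOfRecord₁₁CB10YZWB8 (isRecordOfRecord₁₁CB10YZWB8_of_isRecordOfRecord₁₁CB10YZWB8B12 h)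
  exact ⟨w', isRecordOfRecord₁₁C_of_isRecordOfRecord₁₁CB10YZW hw', hC, hγ, hL, hleaves⟩

/-- **THE SIX PINNED LEAVES AT A RECORD OF THIS MODULE, for ONE parameter package**. [cite: Balaban1987RG1, Lemma 4 p.280; Balaban1985RegularSpaces, Lemma 1 – Thm 8 pp.79–101; Balaban1989LargeFieldI, Prop. 1 p.194; Balaban1985BackgroundPropagators, Thm 3.1 p.397; Balaban1985UV3, Thm 1 p.257; Balaban1985Variational, Thm 1 p.279] -/
theorem leaves_iff_of_isRecordOfRecord₁₁CB10YZWB8B12 (h : IsRecordOfRecord₁₁CB10YZWB8B12 F N D w) :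
    ∃ (θ : Stage11Params F N) (lam12 : ResidB12 F N θ.τ9.M) (lam : ResidB8 θ.toStage3Params) (Mstar : ℕ) (ops : OpsY N θ.toStage3Params Mstar) (ζ : ResidZ F N)
      (lamW : ResidW F N), θ.Admissible ∧ w.L = (θ.L : ℝ) ∧ ∀ P : B12.RunParams,
        ((leavesP w P).b12 ↔ B12LeafOfRecord₁₁ F N θ lam12 P) ∧ ((leavesP w P).b8 ↔ B8LeafOfRecord θ.toStage3Params lam) ∧
        ((leavesP w P).rBasicStep ↔ B15Leaf (WOfRecord₁₁ F N θ lamW P)) ∧ ((leavesP w P).b9 ↔ B9LeafX (Y9OfRecord N θ.toStage3Params Mstar ops)) ∧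
        ((leavesP w P).b10 ↔ PrintedUV3V N θ.L) ∧ ((leavesP w P).b11 ↔ B11Leaf (Z11OfRecord F N ζ)) := by
  obtain ⟨θ, -, lam12, lam, Mstar, ops, ζ, lamW, hθ, -, -, -, hL, hup⟩ := h
  refine ⟨θ, lam12, lam, Mstar, ops, ζ, lamW, hθ, hL, fun P => ?_⟩
  have hl := upOfRecord₅CS_view₁₁B12B8B10YZW_leaves F N θ lam12 lam Mstar ops ζ lamW P
  refine ⟨?_, ?_, ?_, ?_, ?_, ?_⟩
  · show (w.up P).b12 ↔ _
    rw [hup P]; exact hl.1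
  · show (w.up P).b8 ↔ _
    rw [hup P]; exact hl.2.1
  · show (w.up P).rBasicStep ↔ _
    rw [hup P]; exact hl.2.2.1
  · show (w.up P).b9 ↔ _
    rw [hup P]; exact hl.2.2.2.1
  · show (w.up P).b10 ↔ _
    rw [hup P]; exact hl.2.2.2.2.1
  · show (w.up P).b11 ↔ _
    rw [hup P]; exact hl.2.2.2.2.2

/-- **THE OWN LEAF OF N09's CONJUNCT 1 AT A RECORD OF THIS MODULE**: `b12` IS Lemma 4 at the group of record, for one parameter package.
[cite: Balaban1987RG1, Lemma 4 (3.53) p.280 (the leaf at the objects of record)] -/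
theorem leaf_b12_iff_of_isRecordOfRecord₁₁CB10YZWB8B12 (h : IsRecordOfRecord₁₁CB10YZWB8B12 F N D w) :
    ∃ (θ : Stage11Params F N) (lam12 : ResidB12 F N θ.τ9.M), θ.Admissible ∧ ∀ P : B12.RunParams, (leavesP w P).b12 ↔ B12LeafOfRecord₁₁ F N θ lam12 P := by
  obtain ⟨θ, lam12, _, _, _, _, _, hθ, -, hl⟩ := leaves_iff_of_isRecordOfRecord₁₁CB10YZWB8B12 h
  exact ⟨θ, lam12, hθ, fun P => (hl P).1⟩

/-- **N09's CONJUNCT 1 «SLOTS» FORM at a record of this module**: the leaf `b12` at every run from a closer at every presenting parameter package (a closer supplies the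
companion's face «displayed by-reference package ⇒ `B12LeafOfRecord₁₁`»). [cite: Balaban1987RG1, Lemma 4 (3.53) p.280 (the node's conjunct 1, bookkeeping)] -/
theorem b12_leaf_of_isRecordOfRecord₁₁CB10YZWB8B12_of_slots (h : IsRecordOfRecord₁₁CB10YZWB8B12 F N D w)
    (hB : ∀ (θ : Stage11Params F N) (hP : θ.Provisos₁₁) (lam12 : ResidB12 F N θ.τ9.M) (lam : ResidB8 θ.toStage3Params) (Mstar : ℕ) (ops : OpsY N θ.toStage3Params Mstar)
      (ζ : ResidZ F N) (lamW : ResidW F N), θ.Admissible → D = datumOfRecord₁₁ F N θ hP →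
        (∀ P, w.up P = upOfRecord₅CS F N (θ.view₁₁B12B8B10YZW F N lam12 lam Mstar ops ζ lamW) P) → ∀ P, B12LeafOfRecord₁₁ F N θ lam12 P)
    (P : B12.RunParams) : (leavesP w P).b12 := by
  obtain ⟨θ, hP, lam12, lam, Mstar, ops, ζ, lamW, hθ, hD, -, -, -, hup⟩ := h
  show (w.up P).b12
  rw [hup P]
  exact (upOfRecord₅CS_view₁₁B12B8B10YZW_b12_iff F N θ lam12 lam Mstar ops ζ lamW P).2 (hB θ hP lam12 lam Mstar ops ζ lamW hθ hD hup P)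

/-- At a record of this module the upper space `U′ᶜ_{k+1}(□₀, a₀, a₁, α₀)` of the leaf is NON-EMPTY for positive radii: the unit pair `(1, 0)` lies in it (pub-balaban's
`unitPair_mem_space` at the frame of record under def-T's residual laws `Provisos₁₁.rzLaws`) — the leaf's `∀ 𝐔` is exercised. [cite: Balaban1987RG1, (1.11)–(1.16) p.262 (non-vacuity of the printed domain)] -/
theorem unitPair_mem_Uprime_of_provisos (θ : Stage11Params F N) (hP : θ.Provisos₁₁) (hθ : θ.Admissible) (lam12 : ResidB12 F N θ.τ9.M) (p : B12.RunParams)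
    {a₀ a₁ : ℝ} (h₀ : 0 < a₀) (h₁ : 0 < a₁) (hα₀ : 0 < (lam12 p).α₀) :
    B12RegularSpaces111Mono.unitPair ∈ (F12OfRecord₁₁ F N θ lam12 p).Uprime a₀ a₁ :=
  B12RegularSpaces111Mono.unitPair_mem_space ((lam12 p).frameBox (θ.Rz p.K)) (ne_of_gt (pow_pos (inv_pos.mpr (Nat.cast_pos.mpr (F.P p.K).L_pos)) _))
    (Sect2.L_cast_ne_zero (F.P p.K)) hθ.pos.1 h₀ h₁ hα₀ ((hP.rzLaws p.K).bgI_Un_one _ _) ((hP.rzLaws p.K).bgI_Jn_one _ _)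

/-- RE-BINDING a `₁₁C` record's world by the S-binding at the six-pin view gives a record of this module with the SAME datum. [cite: Balaban1989LargeFieldII, Thm 1 p.355 (bookkeeping)] -/
theorem isRecordOfRecord₁₁CB10YZWB8B12_rebind_of_isRecordOfRecord₁₁C (h : IsRecordOfRecord₁₁C F N D w) :
    ∃ (θ : Stage11Params F N) (_ : θ.Provisos₁₁), θ.Admissible ∧ (∀ P, w.up P = upOfRecord₅C F N (θ.toStage5₁₁ F N) P) ∧
      ∀ (lam12 : ResidB12 F N θ.τ9.M) (lam : ResidB8 θ.toStage3Params) (Mstar : ℕ) (ops : OpsY N θ.toStage3Params Mstar) (ζ : ResidZ F N) (lamW : ResidW F N),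
        IsRecordOfRecord₁₁CB10YZWB8B12 F N D { w with up := fun P => upOfRecord₅CS F N (θ.view₁₁B12B8B10YZW F N lam12 lam Mstar ops ζ lamW) P } := by
  obtain ⟨θ, hP, hθ, hD, hC, hγ, hL, hup⟩ := h
  exact ⟨θ, hP, hθ, hup, fun lam12 lam Mstar ops ζ lamW => ⟨θ, hP, lam12, lam, Mstar, ops, ζ, lamW, hθ, hD, hC, hγ, hL, fun _ => rfl⟩⟩

end Record11B12

end Literature.MathematicalPhysics.QuantumFieldTheory.Balaban1983to89.Node00

end
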